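import Mathlib
import Literature.NumberTheory.GaloisRepresentations.UnitsHerbrand
import Literature.NumberTheory.GaloisRepresentations.UnitIdelesHerbrand
import HarnessLib

/-!
# Nine norm-one units modulo `σ`-coboundaries in a cyclic cubic extension of a totally complex field

For a cyclic cubic extension of number fields `L/F` with `Gal(L/F) = ⟨σ⟩`, `F` totally complex,
and a unit `u ∈ 𝓞_Fˣ` which is not the norm of a unit of `L` and such that every unit of `F` is
`uⁱ v³`: there are nine units of `L` of relative norm `1`, pairwise inequivalent modulo the
`σ`-coboundaries `σ(η)/η` of units, i.e. `#Ĥ⁻¹(⟨σ⟩, 𝓞_Lˣ) ≥ 9`.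

This is the unit-cohomology input of Chevalley's ambiguous class argument, obtained from the
tree's unit Herbrand quotient `MinkowskiUnit.card_mul_h0_unitsE_eq` (Childress, *Class Field
Theory*, Ch. 4 §5 Prop. 5.10): `#G · #Ĥ⁰(G, 𝓞_Lˣ) = 2^a · #Ĥ⁻¹(G, 𝓞_Lˣ)` with `#G = 3`,
`2^a = archFactor F L = 1` (all infinite places of `F` are complex, hence unramified in `L`:
trivial stabilisers) and `#Ĥ⁰ = [𝓞_Fˣ : N(𝓞_Lˣ)] = 3` (the `σ`-fixed units of `L` are the units
of `F`; the norm subgroup has the three cosets of `1, u, u²`), so `#Ĥ⁻¹ = 9`; unfolding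
`Ĥ⁻¹ = {norm-one units}/{σ(η)/η}` gives nine coset representatives.
-/

set_option linter.dupNamespace false

noncomputable section

open NumberField

open scoped Pointwise NumberField

namespace Summit.QuantumAdvantage.QuantumAdvantage.Theorems.LinnikCubicClassGroups

open Literature.NumberTheory.GaloisRepresentations
open Literature.NumberTheory.GaloisRepresentations.MinkowskiUnit

universe u

/-! ### Pure group theory: a subgroup of index `3` -/

/-- In a commutative group, a subgroup `N` with `u ∉ N`, containing all cubes, and such that every
element is `uⁱ v³`, has index `3` (the quotient is cyclic of order `3` generated by `u`).
[folklore] -/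
theorem index_eq_three_of_cube {M : Type*} [CommGroup M] {N : Subgroup M} {u : M} (hu : u ∉ N)
    (hcube : ∀ v : M, v ^ 3 ∈ N) (hgen : ∀ w : M, ∃ i : ℕ, ∃ v : M, w = u ^ i * v ^ 3) :
    N.index = 3 := by
  have hq3 : ((u : M ⧸ N)) ^ 3 = 1 := by
    rw [← QuotientGroup.mk_pow, QuotientGroup.eq_one_iff]
    exact hcube u
  have hq1 : (u : M ⧸ N) ≠ 1 := fun h => hu ((QuotientGroup.eq_one_iff u).mp h)
  have hord : orderOf (u : M ⧸ N) = 3 := orderOf_eq_prime hq3 hq1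
  have hall : ∀ x : M ⧸ N, x ∈ Subgroup.zpowers (u : M ⧸ N) := by
    intro x
    obtain ⟨w, rfl⟩ := QuotientGroup.mk_surjective x
    obtain ⟨i, v, rfl⟩ := hgen w
    rw [QuotientGroup.mk_mul, QuotientGroup.mk_pow, (QuotientGroup.eq_one_iff _).mpr (hcube v),
      mul_one]
    exact Subgroup.npow_mem_zpowers _ _
  rw [Subgroup.index_eq_card, ← orderOf_eq_card_of_forall_mem_zpowers hall, hord]

/-! ### Global units of `L` and of `F` inside `Lˣ` -/

variable {F : Type u} {L : Type u} [Field F] [NumberField F] [Field L] [NumberField L] [Algebra F L]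

/-! The inclusions `𝓞_Lˣ → Lˣ` (with range `unitsE L`) and `𝓞_Fˣ → Lˣ` are
`Units.map (algebraMap (𝓞 L) L : 𝓞 L →* L)` and `Units.map (algebraMap (𝓞 F) L : 𝓞 F →* L)`. -/

omit [NumberField F] [NumberField L] in
/-- Values of `𝓞_Fˣ → Lˣ`. [folklore] -/
theorem val_unitsMap_base (w : (𝓞 F)ˣ) :
    ((Units.map (algebraMap (𝓞 F) L : 𝓞 F →* L) w : Lˣ) : L) = algebraMap F L ((w : 𝓞 F) : F) := by
  rw [Units.coe_map, MonoidHom.coe_coe, IsScalarTower.algebraMap_apply (𝓞 F) F L,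
    RingOfIntegers.coe_eq_algebraMap]

omit [NumberField F] [NumberField L] in
/-- `𝓞_Fˣ → Lˣ` factors through `𝓞_Lˣ`. [folklore] -/
theorem unitsMap_base_eq (w : (𝓞 F)ˣ) :
    Units.map (algebraMap (𝓞 F) L : 𝓞 F →* L) w = Units.map (algebraMap (𝓞 L) L : 𝓞 L →* L)
      (Units.map (algebraMap (𝓞 F) (𝓞 L) : 𝓞 F →* 𝓞 L) w) := by
  ext
  rw [Units.coe_map, MonoidHom.coe_coe, IsScalarTower.algebraMap_apply (𝓞 F) (𝓞 L) L]
  rfl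

omit [NumberField F] [NumberField L] in
/-- `𝓞_Fˣ ⊆ 𝓞_Lˣ` inside `Lˣ`. [folklore] -/
theorem unitsMap_base_mem_unitsE (w : (𝓞 F)ˣ) :
    Units.map (algebraMap (𝓞 F) L : 𝓞 F →* L) w ∈ unitsE L := by
  rw [unitsMap_base_eq]
  exact ⟨_, rfl⟩

omit [NumberField F] [NumberField L] in
/-- The units of `F` are fixed by `Gal(L/F)`. [folklore] -/
theorem smul_unitsMap_base (g : L ≃ₐ[F] L) (w : (𝓞 F)ˣ) :
    g • Units.map (algebraMap (𝓞 F) L : 𝓞 F →* L) w =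
      Units.map (algebraMap (𝓞 F) L : 𝓞 F →* L) w := by
  ext
  rw [val_smul, val_unitsMap_base, AlgEquiv.commutes]

/-- The value of the Herbrand norm `N_G a = ∏_g g • a` of `a ∈ Lˣ` is `∏_g g(a)`. [folklore] -/
theorem val_herbrandNorm (a : Lˣ) :
    ((Herbrand.norm (L ≃ₐ[F] L) a : Lˣ) : L) = ∏ g : L ≃ₐ[F] L, g (a : L) := by
  rw [Herbrand.norm_apply, Units.coe_prod]
  exact Finset.prod_congr rfl fun g _ => val_smul g a

/-- For global units `x ∈ 𝓞_Lˣ`, `w ∈ 𝓞_Fˣ`: `N_G x = w` in `Lˣ` iff `N_{L/F}(x) = w`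
(`N_G = N_{L/F}` on `L`, `Algebra.norm_eq_prod_automorphisms`). [folklore] -/
theorem herbrandNorm_eq_iff [IsGalois F L] (x : (𝓞 L)ˣ) (w : (𝓞 F)ˣ) :
    Herbrand.norm (L ≃ₐ[F] L) (Units.map (algebraMap (𝓞 L) L : 𝓞 L →* L) x) =
        Units.map (algebraMap (𝓞 F) L : 𝓞 F →* L) w ↔
      Algebra.norm F ((x : 𝓞 L) : L) = ((w : 𝓞 F) : F) := by
  rw [← Units.val_inj, val_herbrandNorm, val_unitsMap, ← Algebra.norm_eq_prod_automorphisms,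
    val_unitsMap_base, (algebraMap F L).injective.eq_iff]

/-- For a global unit `x ∈ 𝓞_Lˣ`: `N_G x = 1` in `Lˣ` iff `N_{L/F}(x) = 1`. [folklore] -/
theorem herbrandNorm_eq_one_iff [IsGalois F L] (x : (𝓞 L)ˣ) :
    Herbrand.norm (L ≃ₐ[F] L) (Units.map (algebraMap (𝓞 L) L : 𝓞 L →* L) x) = 1 ↔
      Algebra.norm F ((x : 𝓞 L) : L) = 1 := by
  rw [← map_one (Units.map (algebraMap (𝓞 F) L : 𝓞 F →* L)), herbrandNorm_eq_iff, Units.val_one,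
    show ((1 : 𝓞 F) : F) = 1 from map_one _]

/-! ### `Ĥ⁰`: the fixed units are the units of `F` -/

/-- For `Gal(L/F) = ⟨σ⟩`, the `σ`-fixed global units of `L` are the global units of `F`:
`z0(𝓞_Lˣ) = 𝓞_Fˣ` inside `Lˣ` (a unit of `𝓞_L` lying in `F` is a unit of `𝓞_F`). [folklore] -/
theorem z0_unitsE_eq_range [IsGalois F L] {σ : L ≃ₐ[F] L}
    (hσ : ∀ τ : L ≃ₐ[F] L, τ ∈ Subgroup.zpowers σ) :
    Herbrand.z0 σ (unitsE L) ⊥ = (Units.map (algebraMap (𝓞 F) L : 𝓞 F →* L)).range := by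
  ext a
  rw [Herbrand.mem_z0_bot]
  constructor
  · rintro ⟨⟨x, rfl⟩, hfix⟩
    have hall : ∀ g : L ≃ₐ[F] L, g ((x : 𝓞 L) : L) = ((x : 𝓞 L) : L) := fun g =>
      congrArg Units.val ((Herbrand.forall_smul_eq_iff hσ).mpr hfix g)
    obtain ⟨y, hy⟩ := (IsGalois.mem_range_algebraMap_iff_fixed ((x : 𝓞 L) : L)).mpr hall
    have hyint : IsIntegral ℤ y := by
      rw [← isIntegral_algebraMap_iff (algebraMap F L).injective, hy]
      exact RingOfIntegers.isIntegral_coe (x : 𝓞 L)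
    obtain ⟨y₀, rfl⟩ : ∃ y₀ : 𝓞 F, (y₀ : F) = y := ⟨⟨y, hyint⟩, rfl⟩
    have hy₀ : algebraMap (𝓞 F) (𝓞 L) y₀ = (x : 𝓞 L) := by
      apply RingOfIntegers.ext
      rw [RingOfIntegers.coe_eq_algebraMap, ← IsScalarTower.algebraMap_apply (𝓞 F) (𝓞 L) L,
        IsScalarTower.algebraMap_apply (𝓞 F) F L, ← RingOfIntegers.coe_eq_algebraMap, hy]
    have hunit : IsUnit y₀ := by
      rw [← isUnit_pow_iff (Module.finrank_pos (R := F) (M := L)).ne',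
        ← RingOfIntegers.norm_algebraMap F y₀, hy₀]
      exact (RingOfIntegers.isUnit_norm_of_isGalois F).mpr (Units.isUnit x)
    refine ⟨hunit.unit, ?_⟩
    rw [unitsMap_base_eq]
    congr 1
    ext
    rw [Units.coe_map, MonoidHom.coe_coe, IsUnit.unit_spec, hy₀]
  · rintro ⟨w, rfl⟩
    exact ⟨unitsMap_base_mem_unitsE w, smul_unitsMap_base σ w⟩

/-- For `Gal(L/F) = ⟨σ⟩`: `#Ĥ⁰(G, 𝓞_Lˣ)` is the index in `𝓞_Fˣ` of the subgroup of norms of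
global units of `L` (pulled back along `𝓞_Fˣ → Lˣ`). [folklore] -/
theorem h0_unitsE_eq_index [IsGalois F L] {σ : L ≃ₐ[F] L}
    (hσ : ∀ τ : L ≃ₐ[F] L, τ ∈ Subgroup.zpowers σ) :
    Herbrand.h0 σ (unitsE L) ⊥ = (((unitsE L).map (Herbrand.norm (L ≃ₐ[F] L))).comap
      (Units.map (algebraMap (𝓞 F) L : 𝓞 F →* L))).index := by
  rw [Herbrand.h0_def, Herbrand.b0_bot, z0_unitsE_eq_range hσ, MonoidHom.range_eq_map,
    ← Subgroup.relIndex_comap, Subgroup.relIndex_top_right]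

/-- Membership in the pulled-back norm subgroup: `w` is the relative norm of a unit of `L`.
[folklore] -/
theorem mem_comap_map_norm_iff [IsGalois F L] (w : (𝓞 F)ˣ) :
    w ∈ ((unitsE L).map (Herbrand.norm (L ≃ₐ[F] L))).comap
        (Units.map (algebraMap (𝓞 F) L : 𝓞 F →* L)) ↔
      ∃ ε : (𝓞 L)ˣ, Algebra.norm F ((ε : 𝓞 L) : L) = ((w : 𝓞 F) : F) := by
  rw [Subgroup.mem_comap, Subgroup.mem_map]
  constructor
  · rintro ⟨_, ⟨ε, rfl⟩, hε⟩
    exact ⟨ε, (herbrandNorm_eq_iff ε w).mp hε⟩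
  · rintro ⟨ε, hε⟩
    exact ⟨_, ⟨ε, rfl⟩, (herbrandNorm_eq_iff ε w).mpr hε⟩

/-! ### The stub -/

/-- STUB 5 (L, generic) — NINE NORM-ONE UNITS: for `L/F` cyclic cubic generated by `σ` with `F`
totally complex, and a unit `u` of `F` that is not the norm of a unit of `L` while every unit of
`F` is `uⁱ v³`, there are nine units of `L` of relative norm `1` pairwise inequivalent modulo
`σ(η)/η`, `η ∈ 𝓞_Lˣ` (i.e. `#Ĥ⁻¹(⟨σ⟩, 𝓞_Lˣ) ≥ 9`).  From the
tree `MinkowskiUnit.card_mul_h0_unitsE_eq` (`3 · #Ĥ⁰ = 2^a · #Ĥ⁻¹`, Childress Prop. 5.10) with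
`2^a = archFactor F L = 1` (complex places are unramified: trivial stabilisers) and
`#Ĥ⁰ = [𝓞_Fˣ : N 𝓞_Lˣ] = 3` (cosets `1, u, u²`). -/
theorem stub_unitsNormOne9 :
    ∀ (F L : Type) [Field F] [NumberField F] [Field L] [NumberField L] [Algebra F L]
      [IsGalois F L] (σ : L ≃ₐ[F] L), (∀ τ : L ≃ₐ[F] L, τ ∈ Subgroup.zpowers σ) →
      Module.finrank F L = 3 →
      (∀ v : NumberField.InfinitePlace F, v.IsComplex) →
      ∀ u : (𝓞 F)ˣ,
        (∀ ε : (𝓞 L)ˣ, Algebra.norm F (((ε : 𝓞 L) : L)) ≠ ((u : 𝓞 F) : F)) →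
        (∀ w : (𝓞 F)ˣ, ∃ i : ℕ, ∃ v : (𝓞 F)ˣ, w = u ^ i * v ^ 3) →
        (∃ ε : Fin 9 → (𝓞 L)ˣ,
          (∀ i, Algebra.norm F (((ε i : 𝓞 L) : L)) = 1) ∧
          ∀ i j, i ≠ j → ∀ η : (𝓞 L)ˣ,
            (((ε i : 𝓞 L) : L)) * ((η : 𝓞 L) : L) ≠ (((ε j : 𝓞 L) : L)) * σ ((η : 𝓞 L) : L)) := by
  intro F L _ _ _ _ _ _ σ hσ hdeg hcx u hu hgen
  classical
  -- (1) `#G = 3`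
  have hcard : Fintype.card (L ≃ₐ[F] L) = 3 := by
    rw [Fintype.card_eq_nat_card, IsGalois.card_aut_eq_finrank, hdeg]
  -- (2) `archFactor F L = 1`: complex places of `F` are unramified in `L`
  have harch : ArchHerbrand.archFactor F L = 1 := by
    refine Finset.prod_eq_one fun v _ => ?_
    have hw : (ArchHerbrand.placeOver L v).IsUnramified F := by
      rw [NumberField.InfinitePlace.isUnramified_iff]
      refine Or.inr ?_
      rw [show (ArchHerbrand.placeOver L v).comap (algebraMap F L) = v from
        ArchHerbrand.isOver_placeOver v]
      exact hcx v
    exact NumberField.InfinitePlace.isUnramified_iff_card_stabilizer_eq_one.mp hw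
  -- (3) `#Ĥ⁰ = [𝓞_Fˣ : N 𝓞_Lˣ] = 3`
  have hcube : ∀ v : (𝓞 F)ˣ, v ^ 3 ∈ ((unitsE L).map (Herbrand.norm (L ≃ₐ[F] L))).comap
      (Units.map (algebraMap (𝓞 F) L : 𝓞 F →* L)) := by
    intro v
    rw [mem_comap_map_norm_iff]
    refine ⟨Units.map (algebraMap (𝓞 F) (𝓞 L) : 𝓞 F →* 𝓞 L) v, ?_⟩
    rw [Units.coe_map, MonoidHom.coe_coe, RingOfIntegers.coe_eq_algebraMap,
      ← IsScalarTower.algebraMap_apply, IsScalarTower.algebraMap_apply (𝓞 F) F L,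
      Algebra.norm_algebraMap, hdeg, Units.val_pow_eq_pow_val, RingOfIntegers.coe_eq_algebraMap,
      map_pow]
  have hu' : u ∉ ((unitsE L).map (Herbrand.norm (L ≃ₐ[F] L))).comap
      (Units.map (algebraMap (𝓞 F) L : 𝓞 F →* L)) := by
    rw [mem_comap_map_norm_iff]
    rintro ⟨ε, hε⟩
    exact hu ε hε
  have h0 : Herbrand.h0 σ (unitsE L) ⊥ = 3 := by
    rw [h0_unitsE_eq_index hσ]
    exact index_eq_three_of_cube hu' hcube hgen
  -- (4) `#Ĥ⁻¹ = 9` by the unit Herbrand quotient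
  have h1 : Herbrand.h1 σ (unitsE L) ⊥ = 9 := by
    obtain ⟨hmain, -⟩ := MinkowskiUnit.card_mul_h0_unitsE_eq (F := F) (E := L) hσ
    rw [hcard, h0, harch, one_mul] at hmain
    omega
  -- (5) nine cosets of `{σ η / η}` in the norm-one units, pulled back to `𝓞_Lˣ`
  obtain ⟨Z, hZ⟩ : ∃ Z : Subgroup (𝓞 L)ˣ, Z = (Herbrand.z1 (L ≃ₐ[F] L) (unitsE L) ⊥).comap
      (Units.map (algebraMap (𝓞 L) L : 𝓞 L →* L)) := ⟨_, rfl⟩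
  obtain ⟨B, hB⟩ : ∃ B : Subgroup (𝓞 L)ˣ, B = (Herbrand.b1 σ (unitsE L) ⊥).comap
      (Units.map (algebraMap (𝓞 L) L : 𝓞 L →* L)) := ⟨_, rfl⟩
  have hidx : Nat.card (Z ⧸ B.subgroupOf Z) = 9 := by
    rw [← h1, Herbrand.h1_def, ← Subgroup.index_eq_card]
    change B.relIndex Z = _
    rw [hB, Subgroup.relIndex_comap, hZ, Subgroup.map_comap_eq, show (Units.map
        (algebraMap (𝓞 L) L : 𝓞 L →* L)).range = unitsE L from rfl, inf_eq_right.mpr Herbrand.z1_le]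
  have hfin : Nat.card (Z ⧸ B.subgroupOf Z) ≠ 0 := by omega
  obtain ⟨e⟩ : Nonempty ((Z ⧸ B.subgroupOf Z) ≃ Fin 9) :=
    ⟨(Nat.equivFinOfCardPos hfin).trans (finCongr hidx)⟩
  obtain ⟨s, hs⟩ := (QuotientGroup.mk_surjective (s := B.subgroupOf Z)).hasRightInverse
  refine ⟨fun i => ((s (e.symm i) : Z) : (𝓞 L)ˣ), fun i => ?_, fun i j hij η heq => hij ?_⟩
  · -- norm one
    have hmem := hZ.le (s (e.symm i)).2
    rw [Subgroup.mem_comap, Herbrand.mem_z1_bot] at hmem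
    exact (herbrandNorm_eq_one_iff _).mp hmem.2
  · -- distinct classes modulo `σ`-coboundaries
    apply e.symm.injective
    rw [← hs (e.symm i), ← hs (e.symm j), QuotientGroup.eq, Subgroup.mem_subgroupOf,
      Subgroup.coe_mul, Subgroup.coe_inv]
    refine hB.ge ?_
    rw [Subgroup.mem_comap, map_mul, map_inv, Herbrand.b1_bot]
    refine ⟨(Units.map (algebraMap (𝓞 L) L : 𝓞 L →* L) η)⁻¹, (unitsE L).inv_mem ⟨η, rfl⟩, ?_⟩
    -- `(σ • η / η)⁻¹ = εᵢ⁻¹ εⱼ` in `Lˣ`, from `εᵢ η = εⱼ σ(η)` in `L`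
    have hunits : Units.map (algebraMap (𝓞 L) L : 𝓞 L →* L) (s (e.symm i) : (𝓞 L)ˣ) *
          Units.map (algebraMap (𝓞 L) L : 𝓞 L →* L) η =
        Units.map (algebraMap (𝓞 L) L : 𝓞 L →* L) (s (e.symm j) : (𝓞 L)ˣ) *
          (σ • Units.map (algebraMap (𝓞 L) L : 𝓞 L →* L) η) := by
      ext
      rw [Units.val_mul, Units.val_mul, val_smul, val_unitsMap, val_unitsMap, val_unitsMap]
      exact heq
    rw [map_inv, Herbrand.twist_apply, inv_div, div_eq_iff_eq_mul, mul_assoc,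
      eq_inv_mul_iff_mul_eq]
    exact hunits
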